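import Literature.AlgebraicGeometry.AbelianSchemes.SerreTensorIdealTranslationKernel
import Literature.AlgebraicGeometry.GroupSchemes.GroupSchemeKernelShear
import HarnessLib

/-!
# The kernel group SCHEME of the ideal translation `ψ_P : A ⟶ A ⊗_𝒪 𝔟`: `Ker ψ_P ≅ ⋂_k Ker ι(P_k) = A[𝔭]`, and the degree of `ψ_P`

Topic `AlgebraicGeometry/AbelianSchemes`, namespaces `Literature.AlgebraicGeometry.GroupSchemes.GroupSchemeKernel` (§1, generic: two morphisms into group
objects with the same kernel ON POINTS have isomorphic kernel objects) and `Literature.AlgebraicGeometry.AbelianSchemes.AbelianSchemeOver` (§2–§3).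
Constructions with bodies + proved theorems; no named fact, no `sorry`, no `instance`, no notation; ANY base scheme `S`.  Cell `hodgecm-mathlib`, F0/P6 «MOD»,
sequel to ★ (A) `SerreTensorIdealTranslationKernel` (p845164) serving the DEGREE clause of the recognition form ★ `SerreTensorRecognition`
(`hdψ : ∀ c, ψ_P.left.finrank c = d`): the kernel of `ψ_P` as a group SCHEME is the scheme-theoretic `𝔭`-torsion `A[𝔭] = ⋂_k Ker ι(P_k)` (the kernel of the
tuple map `(ι(P_k))_k : A → Aᵐ`), so the rank of `ψ_P` is the rank of `A[𝔭] → S` (★ `GroupSchemeKernelShear.finrank_left_apply_eq_finrank_hom`);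
`--supports stmt-HodgeConjecture-24832`, count-neutral.  HC_CM is proved only modulo the 2 remaining named inputs (hLiu418, h413) until rung 0 closes; this file
discharges none of them.

## Mathematics

`ψ_P ≫ ι = τ_P` where `ι : A ⊗ 𝔟 ↪ Aᵐ` is the (mono) inclusion of `Fix([E′])` and `τ_P = (ι(P_k))_k : A → Aᵐ` is the tuple map (§2, from ★
`serreHomEquiv_comp_serreTranslate`).  Hence `t ≫ ψ_P = 1 ↔ t ≫ τ_P = 1 ↔ ∀ k, t ≫ ι(P_k) = 1` and (§1) the kernel objects are isomorphic over `A`: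
**`Ker ψ_P ≅ Ker τ_P = A[P_1, …, P_m] = A[𝔭]`** ([MilneCM2006] §7 Rem. 7.23: `Ker(λ^𝔞) = A[𝔞] = ⋂_{a ∈ 𝔞} Ker a`; finitely many generators suffice).  With the
kernel square transported (Mathlib `IsPullback.of_iso_pullback`), ★ kernel shear gives (§3) **`rank_{ψ_P(x)} ψ_P = rank_{π(x)} (A[𝔭] → S)`** whenever `A[𝔭] → S`
is finite flat — e.g. `= N(𝔭)^{2 dim A ∕ [F:ℚ]}`-type counts supplied by the consumer ([GortzWedhorn2020] Def. 4.45 (2); [StacksProject] 02KA).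

## Contents

* §1 (generic) **`GroupSchemeKernel.kerIsoOfCompEqOneIff f f′ h : ker f ≅ ker f′`** for `h : ∀ T g, g ≫ f = 1 ↔ g ≫ f′ = 1` (+ `_hom_ι`, `_inv_ι`).
* §2 **`idealTuple act P : A.X ⟶ (A.pow m).X`** (`τ_P`), `idealTuple_powProj`, `isMonHom_idealTuple`, **`serreTranslate_comp_serreι`** (`ψ_P ≫ ι = τ_P`),
  `comp_idealTuple_eq_one_iff`, `comp_serreTranslate_eq_one_iff_comp_idealTuple`, **`kerSerreTranslateIso`** (`Ker ψ_P ≅ Ker τ_P`, + `_hom_ι`, `_inv_ι`), `kerSerreTranslateSmulOneIso` (principal: `≅ Ker ι(a)`).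
* §3 `isPullback_kerι_idealTuple_serreTranslate` (the kernel square of `ψ_P` with corner `Ker τ_P`), **`finrank_serreTranslate_left_apply`**
  (`ψ_P.left.finrank (ψ_P.left x) = (Ker τ_P).hom.finrank (A.X.hom x)`), `finrank_serreTranslate_left_eq_of_forall` (constant rank `d`).

## References
* [MilneCM2006] J. S. Milne, *Complex Multiplication* (2006), §7 Def. 7.19, Prop. 7.22, Rem. 7.23 (pp. 58–59).
* [GortzWedhorn2020] U. Görtz, T. Wedhorn, *Algebraic Geometry I* (2nd ed.), Definition 4.45 (2) (p. 117) (kernels as fibre products).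
* [StacksProject] Tag 02KA (rank of a finite locally free morphism under base change).
* Tree: ★ `SerreTensorIdealTranslationKernel`, ★ `GroupSchemes/GroupSchemeKernel`, ★ `GroupSchemes/GroupSchemeKernelShear`.
-/

noncomputable section

universe v u

open CategoryTheory CategoryTheory.Limits AlgebraicGeometry MonoidalCategory CartesianMonoidalCategory
open scoped MonObj

/-! ## §1 Same kernel on points ⇒ isomorphic kernel objects -/

namespace Literature.AlgebraicGeometry.GroupSchemes

namespace GroupSchemeKernel

section General

variable {C : Type u} [Category.{v} C] [CartesianMonoidalCategory C] {G H H' : C} [GrpObj H] [GrpObj H']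
  (f : G ⟶ H) (f' : G ⟶ H') [HasPullback f η[H]] [HasPullback f' η[H']]
  (h : ∀ {T : C} (g : T ⟶ G), g ≫ f = 1 ↔ g ≫ f' = 1)

/-- **Two morphisms `f : G → H`, `f′ : G → H′` into group objects with the same kernel ON POINTS (`g ≫ f = 1 ↔ g ≫ f′ = 1`) have isomorphic kernel
objects over `G`.** [cite: GortzWedhorn2020, Definition 4.45 (2) (p. 117)] -/
def kerIsoOfCompEqOneIff : ker f ≅ ker f' where
  hom := kerLift (kerι f) ((h _).1 (kerι_comp f))
  inv := kerLift (kerι f') ((h _).2 (kerι_comp f'))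
  hom_inv_id := ker_hom_ext (by rw [Category.assoc, kerLift_ι, kerLift_ι, Category.id_comp])
  inv_hom_id := ker_hom_ext (by rw [Category.assoc, kerLift_ι, kerLift_ι, Category.id_comp])

/-- `hom ≫ ι′ = ι`. [cite: GortzWedhorn2020, Definition 4.45 (2) (p. 117)] -/
@[reassoc]
theorem kerIsoOfCompEqOneIff_hom_ι : (kerIsoOfCompEqOneIff f f' h).hom ≫ kerι f' = kerι f :=
  kerLift_ι (kerι f) ((h _).1 (kerι_comp f))

/-- `inv ≫ ι = ι′`. [cite: GortzWedhorn2020, Definition 4.45 (2) (p. 117)] -/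
@[reassoc]
theorem kerIsoOfCompEqOneIff_inv_ι : (kerIsoOfCompEqOneIff f f' h).inv ≫ kerι f = kerι f' :=
  kerLift_ι (kerι f') ((h _).2 (kerι_comp f'))

end General

end GroupSchemeKernel

end Literature.AlgebraicGeometry.GroupSchemes

/-! ## §2 `Ker ψ_P ≅ Ker τ_P = A[𝔭]` -/

namespace Literature.AlgebraicGeometry.AbelianSchemes

namespace AbelianSchemeOver

open Literature.AlgebraicGeometry.GroupSchemes GroupSchemeKernel

variable {S : Scheme.{u}} {A : AbelianSchemeOver S} {O : Type*} [CommRing O] (act : A.RingAction O)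

section Tuple

variable {m : ℕ} (P : Matrix (Fin m) (Fin 1) O)

/-- **The tuple map `τ_P = (ι(P_k))_k : A → Aᵐ`** of a column `P`; its kernel is `⋂_k Ker ι(P_k) = A[P_1, …, P_m]`. [cite: MilneCM2006, §7 (Def. 7.19, Prop. 7.22, Rem. 7.23, pp. 58–59)] -/
def idealTuple : A.X ⟶ (A.pow m).X := powLift fun k => act.i (P k 0)

/-- `τ_P ≫ pr_k = ι(P_k)`. [cite: MilneCM2006, §7 (Def. 7.19, Prop. 7.22, Rem. 7.23, pp. 58–59)] -/
@[reassoc]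
theorem idealTuple_powProj (k : Fin m) : idealTuple act P ≫ A.powProj m k = act.i (P k 0) := powLift_powProj _ _

/-- `τ_P` is a homomorphism. [cite: MilneCM2006, §7 (Def. 7.19, Prop. 7.22, Rem. 7.23, pp. 58–59)] -/
theorem isMonHom_idealTuple : IsMonHom (idealTuple act P) := isMonHom_powLift _ fun k => act.isMonHom (P k 0)

/-- **The kernel of `τ_P` on points**: `t ≫ τ_P = 1 ↔ ∀ k, t ≫ ι(P_k) = 1`. [cite: MilneCM2006, §7 (Def. 7.19, Prop. 7.22, Rem. 7.23, pp. 58–59)] -/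
theorem comp_idealTuple_eq_one_iff {T : Over S} (t : T ⟶ A.X) : t ≫ idealTuple act P = 1 ↔ ∀ k, t ≫ act.i (P k 0) = 1 := by
  constructor
  · intro ht k
    haveI := A.isMonHom_powProj m k
    rw [← idealTuple_powProj act P k, ← Category.assoc, ht, MonObj.one_comp]
  · intro ht
    refine pow_hom_ext fun k => ?_
    haveI := A.isMonHom_powProj m k
    rw [Category.assoc, idealTuple_powProj, ht k, MonObj.one_comp]

end Tuple

section Kernel

variable [IsCommMonObj A.X] {m : ℕ} (E' : Matrix (Fin m) (Fin m) O) (hE' : E' * E' = E') (P : Matrix (Fin m) (Fin 1) O)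

/-- **`ψ_P ≫ ι = τ_P`**: followed by the inclusion `A ⊗ 𝔟 ↪ Aᵐ`, the ideal translation IS the tuple map. [cite: Conrad2004GrossZagier, §7 (Thm. 7.5)] -/
theorem serreTranslate_comp_serreι (hP : E' * P = P) : serreTranslate act E' hE' P ≫ serreι act E' hE' = idealTuple act P := by
  refine pow_hom_ext fun k => ?_
  have h := serreHomEquiv_comp_serreTranslate act E' hE' P hP (𝟙 A.X) k
  rw [serreHomEquiv_apply_coe, Category.id_comp, Category.id_comp] at h
  rw [h, idealTuple_powProj]

/-- `Ker ψ_P = Ker τ_P` ON POINTS: `t ≫ ψ_P = 1 ↔ t ≫ τ_P = 1`. [cite: MilneCM2006, §7 (Def. 7.19, Prop. 7.22, Rem. 7.23, pp. 58–59)] -/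
theorem comp_serreTranslate_eq_one_iff_comp_idealTuple (hP : E' * P = P) {T : Over S} (t : T ⟶ A.X) :
    t ≫ serreTranslate act E' hE' P = 1 ↔ t ≫ idealTuple act P = 1 := by
  rw [comp_serreTranslate_eq_one_iff act E' hE' P hP t, comp_idealTuple_eq_one_iff]

/-- **`Ker ψ_P ≅ Ker τ_P` (`= A[𝔭]`, the scheme-theoretic torsion of the ideal generated by the coordinates of `P`)**, over `A`.
[cite: MilneCM2006, §7 (Def. 7.19, Prop. 7.22, Rem. 7.23, pp. 58–59)] [cite: GortzWedhorn2020, Definition 4.45 (2) (p. 117)] -/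
def kerSerreTranslateIso (hP : E' * P = P) : ker (serreTranslate act E' hE' P) ≅ ker (idealTuple act P) :=
  kerIsoOfCompEqOneIff (serreTranslate act E' hE' P) (idealTuple act P) (comp_serreTranslate_eq_one_iff_comp_idealTuple act E' hE' P hP)

/-- `hom ≫ ι_{τ} = ι_{ψ}`. [cite: GortzWedhorn2020, Definition 4.45 (2) (p. 117)] -/
@[reassoc]
theorem kerSerreTranslateIso_hom_ι (hP : E' * P = P) :
    (kerSerreTranslateIso act E' hE' P hP).hom ≫ kerι (idealTuple act P) = kerι (serreTranslate act E' hE' P) :=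
  kerIsoOfCompEqOneIff_hom_ι _ _ (comp_serreTranslate_eq_one_iff_comp_idealTuple act E' hE' P hP)

/-- `inv ≫ ι_{ψ} = ι_{τ}`. [cite: GortzWedhorn2020, Definition 4.45 (2) (p. 117)] -/
@[reassoc]
theorem kerSerreTranslateIso_inv_ι (hP : E' * P = P) :
    (kerSerreTranslateIso act E' hE' P hP).inv ≫ kerι (serreTranslate act E' hE' P) = kerι (idealTuple act P) :=
  kerIsoOfCompEqOneIff_inv_ι _ _ (comp_serreTranslate_eq_one_iff_comp_idealTuple act E' hE' P hP)

/-- **Principal case: `Ker ψ_{(a)} ≅ Ker ι(a) = A[a]`.** [cite: MilneCM2006, §7 (Def. 7.19, Prop. 7.22, Rem. 7.23, pp. 58–59)] -/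
def kerSerreTranslateSmulOneIso (a : O) :
    ker (serreTranslate act (1 : Matrix (Fin 1) (Fin 1) O) one_mul_one_fin_one (a • (1 : Matrix (Fin 1) (Fin 1) O))) ≅ ker (act.i a) :=
  haveI := act.isMonHom a
  kerIsoOfCompEqOneIff _ (act.i a) fun t => comp_serreTranslate_smul_one_eq_one_iff act a t

/-! ## §3 The degree of `ψ_P` is the rank of `A[𝔭] → S` -/

/-- **The kernel square of `ψ_P` with corner `Ker τ_P`** is cartesian: `Ker τ_P —ι→ A —ψ_P→ A ⊗ 𝔟 ←η— 𝟙`.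
[cite: GortzWedhorn2020, Definition 4.45 (2) (p. 117)] -/
theorem isPullback_kerι_idealTuple_serreTranslate (hP : E' * P = P) :
    IsPullback (kerι (idealTuple act P)) (toUnit _) (serreTranslate act E' hE' P) η[(serreTensor act E' hE').X] := by
  refine IsPullback.of_iso_pullback ⟨?_⟩ (kerSerreTranslateIso act E' hE' P hP).symm ?_ (toUnit_unique _ _)
  · rw [← Hom.one_def]
    exact (comp_serreTranslate_eq_one_iff act E' hE' P hP _).2 ((comp_idealTuple_eq_one_iff act P _).1 (kerι_comp _))
  · exact kerSerreTranslateIso_inv_ι act E' hE' P hP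

/-- **THE DEGREE OF `ψ_P`**: for `ψ_P.left` finite flat and `A[𝔭] = Ker τ_P → S` finite flat, `rank_{ψ_P(x)} ψ_P = rank_{π(x)} (A[𝔭] → S)`.
[cite: GortzWedhorn2020, Definition 4.45 (2) (p. 117)] [cite: StacksProject, Tag 02KA] -/
theorem finrank_serreTranslate_left_apply (hP : E' * P = P) [IsFinite (serreTranslate act E' hE' P).left] [Flat (serreTranslate act E' hE' P).left]
    [IsFinite (ker (idealTuple act P)).hom] [Flat (ker (idealTuple act P)).hom] (x : A.left) :
    (serreTranslate act E' hE' P).left.finrank ((serreTranslate act E' hE' P).left x) = (ker (idealTuple act P)).hom.finrank (A.X.hom x) := by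
  haveI := isMonHom_serreTranslate act E' hE' P
  exact finrank_left_apply_eq_finrank_hom (serreTranslate act E' hE' P) (kerι (idealTuple act P))
    (isPullback_kerι_idealTuple_serreTranslate act E' hE' P hP) x

/-- **Constant rank**: if `ψ_P.left` is finite flat SURJECTIVE and `A[𝔭] → S` has constant rank `d`, then `ψ_P` has constant rank `d` (the `hdψ` of ★
`exists_iso_serreTranslate_comp_eq_of_forall_comp_eq_one`). [cite: StacksProject, Tag 02KA] -/
theorem finrank_serreTranslate_left_eq_of_forall (hP : E' * P = P) [IsFinite (serreTranslate act E' hE' P).left]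
    [Flat (serreTranslate act E' hE' P).left] [Surjective (serreTranslate act E' hE' P).left]
    [IsFinite (ker (idealTuple act P)).hom] [Flat (ker (idealTuple act P)).hom] (d : ℕ)
    (hd : ∀ s : S, (ker (idealTuple act P)).hom.finrank s = d) (c : (serreTensor act E' hE').left) :
    (serreTranslate act E' hE' P).left.finrank c = d := by
  haveI := isMonHom_serreTranslate act E' hE' P
  exact finrank_left_eq_of_forall_finrank_hom_eq (serreTranslate act E' hE' P) (kerι (idealTuple act P))
    (isPullback_kerι_idealTuple_serreTranslate act E' hE' P hP) d hd c

end Kernel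

end AbelianSchemeOver

end Literature.AlgebraicGeometry.AbelianSchemes

end
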